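import Summits.CriticalPhenomena.PercolationContinuityZ3.Theorems.PercNearOneGluingNoHeavyLowerTailSahiCombTriWGeneral

/-!
# The two-copy rank certificate for `TRI_W(a)` (F-index gauge): rows, the counting bridge, and the explicit target at `a = 2`

Support file of the one-cut programme (crux `NoHeavyLowerTail`, stmt-CriticalPhenomena-4575; cell `prim-masterthm`, TRI lane; seat prim-lf-1 gen 20;
memo `FROM-prim-lf-1-gen20-CERT-L.md`, P5 report §15, memo `FROM-prim-masterthm-p5-g10-TWO-COPY-STRUCTURE.md`).

`FiveUpSet.TriWIneq` (`…SahiCombTriWGeneral`) asks for `0 ≤ triW P F G`; written out,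
`triW P F G = 2·Σ_y #(P ∩ U_y) + Σ_x #(P ∩ T4_x) − Σ_x #(P ∩ D2_x) − Σ_x #(P ∩ D1_x) − Σ_x #(P ∩ D3_x)` with
`U_y = F y ∩ G y`, `D2_x = F x ∩ refl (G xᶜ)`, `D1_x = refl (F x) ∩ G xᶜ`, `D3_x = refl (F x) ∩ refl (G x)`, `T4_x = refl (F x) ∩ refl (G xᶜ)`.
So `triW P F G = #columns − #rows` of any matrix whose rows are indexed by the DEMAND tokens `⊔_x (P∩D2_x ⊔ P∩D1_x ⊔ P∩D3_x)` and whose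
columns are two copies of the SUPPLY tokens `⊔_y P∩U_y` plus the tokens `⊔_x P∩T4_x`; if such a matrix has linearly independent rows then
`0 ≤ triW P F G`.  This file fixes the matrix found to work in every census (memo CERT-L: the 'F-index gauge' with un-netted `D3`,
canonical local `T4` tags and a direction `w (type, x) : Fin 2 → ℚ` per class; with generic directions per class 0 failures on
EXHAUSTIVE general-W `(n,a) = (2,2), (2,3)` [28,224 and 57,471,561 instances, kit j120136] and cylinders `(2,2,2), (2,3,2), (2,2,3)`
[28,224 / 1,273,608 / 1,273,608, kit j120137]; at `a = 2` even with the EXPLICIT 0/1 directions `certSigmaWeight` below) and proves the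
counting bridge:

* `FiveUpSet.certRow` — the row of a demand token: the `D2`/`D1`/`D3` token `d` of class `x` has entry `w (type,x) i · [x ⊆ y][d ⊆ t]` at the
  supply column `((y,t), i)` and, for `D3` tokens only, the tag `[x₀ ⊆ x][e = d]` at the `T4` column `(x₀, e)`;
* **`FiveUpSet.triW_eq_card_sub_card`** — `triW P F G = #columns − #rows` (pure counting, no hypothesis on `P, F, G`);
* **`FiveUpSet.triW_nonneg_of_certRow_linearIndependent`** — if for SOME weight table the rows are linearly independent then `0 ≤ triW P F G`;
* `FiveUpSet.CertKernelZero` — the statement 'for every cube, every `P, F, G` (up-sets, monotone) some weight table makes the rows independent',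
  and **`FiveUpSet.triWIneq_of_certKernelZero : CertKernelZero → TriWIneq`**;
* `FiveUpSet.certSigmaWeight` — the explicit direction table Σ at `a = 2` (by level `#x`: D2 ↦ (e₁+e₂, e₂, e₁), D1 ↦ (e₁, e₁+e₂, e₂),
  D3 ↦ (e₁, e₂, e₁)), the recommended proof target for the cells with a block of size 2.
HONEST LABEL: definitions + an unconditional counting theorem + a conditional bridge; the independence statements themselves (`CertKernelZero`,
or its `a = 2` instance with `certSigmaWeight`) are OPEN (census-clean) and NOT proved here.  For `a = 1` the analogous kernel statement is
`rankZ_kernel_eq_zero` (`…SahiCombFiveUpSetProof`). [this work]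
-/

namespace Summit.CriticalPhenomena.PercolationContinuityZ3.Theorems

namespace FiveUpSet

open Finset

variable {β γ : Type} [DecidableEq β] [Fintype β] [DecidableEq γ] [Fintype γ]

/-! ### Index types of the certificate -/

/-- Demand tokens of class `x`: `D2_x = P ∩ F x ∩ refl (G xᶜ)`, `D1_x = P ∩ refl (F x) ∩ G xᶜ`, `D3_x = P ∩ refl (F x) ∩ refl (G x)`. [this work] -/
abbrev CertRowIdx (P : Finset (Finset γ)) (F G : Finset β → Finset (Finset γ)) : Type :=
  Σ x : Finset β, (↥(P ∩ F x ∩ refl (G xᶜ)) ⊕ (↥(P ∩ refl (F x) ∩ G xᶜ) ⊕ ↥(P ∩ refl (F x) ∩ refl (G x))))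

/-- Supply columns: two copies of `⊔_y P ∩ F y ∩ G y`, plus the `T4` columns `⊔_x P ∩ refl (F x) ∩ refl (G xᶜ)`. [this work] -/
abbrev CertColIdx (P : Finset (Finset γ)) (F G : Finset β → Finset (Finset γ)) : Type :=
  ((Σ y : Finset β, ↥(P ∩ F y ∩ G y)) × Fin 2) ⊕ (Σ x : Finset β, ↥(P ∩ refl (F x) ∩ refl (G xᶜ)))

/-- The row vector of a demand token (F-index gauge, un-netted `D3` with local `T4` tags), for a direction table
`w : Fin 3 × Finset β → Fin 2 → ℚ` (`w (0,x)`, `w (1,x)`, `w (2,x)` = directions of the classes `D2_x`, `D1_x`, `D3_x`). [this work] -/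
def certRow (P : Finset (Finset γ)) (F G : Finset β → Finset (Finset γ)) (w : Fin 3 × Finset β → Fin 2 → ℚ) :
    CertRowIdx P F G → CertColIdx P F G → ℚ
  | ⟨x, Sum.inl d⟩, Sum.inl (⟨y, t⟩, i) => if x ⊆ y ∧ (d : Finset γ) ⊆ (t : Finset γ) then w (0, x) i else 0
  | ⟨_, Sum.inl _⟩, Sum.inr _ => 0
  | ⟨x, Sum.inr (Sum.inl d)⟩, Sum.inl (⟨y, t⟩, i) => if x ⊆ y ∧ (d : Finset γ) ⊆ (t : Finset γ) then w (1, x) i else 0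
  | ⟨_, Sum.inr (Sum.inl _)⟩, Sum.inr _ => 0
  | ⟨x, Sum.inr (Sum.inr d)⟩, Sum.inl (⟨y, t⟩, i) => if x ⊆ y ∧ (d : Finset γ) ⊆ (t : Finset γ) then w (2, x) i else 0
  | ⟨x, Sum.inr (Sum.inr d)⟩, Sum.inr ⟨x₀, e⟩ => if x₀ ⊆ x ∧ (e : Finset γ) = (d : Finset γ) then 1 else 0

/-! ### Counting -/

/-- Number of rows: `Σ_x (#D2_x + #D1_x + #D3_x)` (inside `P`). [this work] -/
theorem card_certRowIdx (P : Finset (Finset γ)) (F G : Finset β → Finset (Finset γ)) :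
    Fintype.card (CertRowIdx P F G)
      = ∑ x : Finset β, ((P ∩ F x ∩ refl (G xᶜ)).card + ((P ∩ refl (F x) ∩ G xᶜ).card + (P ∩ refl (F x) ∩ refl (G x)).card)) := by
  rw [Fintype.card_sigma]
  refine Finset.sum_congr rfl fun x _ => ?_
  rw [Fintype.card_sum, Fintype.card_sum, Fintype.card_coe, Fintype.card_coe, Fintype.card_coe]

/-- Number of columns: `2·Σ_y #(P ∩ U_y) + Σ_x #(P ∩ T4_x)`. [this work] -/
theorem card_certColIdx (P : Finset (Finset γ)) (F G : Finset β → Finset (Finset γ)) :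
    Fintype.card (CertColIdx P F G)
      = (∑ y : Finset β, (P ∩ F y ∩ G y).card) * 2 + ∑ x : Finset β, (P ∩ refl (F x) ∩ refl (G xᶜ)).card := by
  rw [Fintype.card_sum, Fintype.card_prod, Fintype.card_sigma, Fintype.card_sigma, Fintype.card_fin]
  simp only [Fintype.card_coe]

/-- **`triW = #columns − #rows`** of the certificate (pure bookkeeping; no hypothesis on `P, F, G`). [this work] -/
theorem triW_eq_card_sub_card (P : Finset (Finset γ)) (F G : Finset β → Finset (Finset γ)) :
    triW P F G = (Fintype.card (CertColIdx P F G) : ℤ) - Fintype.card (CertRowIdx P F G) := by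
  rw [card_certColIdx, card_certRowIdx]
  unfold triW triWTerm
  push_cast
  rw [Finset.sum_mul, ← Finset.sum_add_distrib, ← Finset.sum_sub_distrib]
  refine Finset.sum_congr rfl fun x _ => ?_
  ring

/-! ### The bridge -/

/-- **Counting bridge.** If for some direction table `w` the certificate rows are linearly independent (over `ℚ`), then `0 ≤ triW P F G`:
independent vectors in `ℚ^{columns}` are at most `#columns` many, and `triW = #columns − #rows`. [this work] -/
theorem triW_nonneg_of_certRow_linearIndependent (P : Finset (Finset γ)) (F G : Finset β → Finset (Finset γ))
    (w : Fin 3 × Finset β → Fin 2 → ℚ) (h : LinearIndependent ℚ (certRow P F G w)) : 0 ≤ triW P F G := by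
  have hcard := h.fintype_card_le_finrank
  rw [Module.finrank_fintype_fun_eq_card] at hcard
  rw [triW_eq_card_sub_card]
  have : (Fintype.card (CertRowIdx P F G) : ℤ) ≤ Fintype.card (CertColIdx P F G) := by exact_mod_cast hcard
  omega

/-- **CERT (kernel form of the two-copy certificate, F-index gauge)** — OPEN, census-clean (memo CERT-L): for every pair of finite cubes, every
up-set `P` and monotone up-set families `F, G`, SOME direction table makes the certificate rows linearly independent.  (Census: generic
directions per class or per `(type, #x)` work on every cell tested; at `a = 2` the explicit table `certSigmaWeight` works.) An obligation of our
theory, never a fact. [this work] -/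
@[conjecture] def CertKernelZero : Prop :=
  ∀ (β γ : Type) [DecidableEq β] [Fintype β] [DecidableEq γ] [Fintype γ]
    (P : Finset (Finset γ)) (F G : Finset β → Finset (Finset γ)),
    IsUpperSet (P : Set (Finset γ)) → (∀ x, IsUpperSet (F x : Set (Finset γ))) → (∀ x, IsUpperSet (G x : Set (Finset γ))) →
    Monotone F → Monotone G → ∃ w : Fin 3 × Finset β → Fin 2 → ℚ, LinearIndependent ℚ (certRow P F G w)

/-- **`CertKernelZero → TriWIneq`**: the kernel form of the certificate implies `TRI_W(a) ≥ 0` for every `a` (hence, via `hybCoeff_eq_tri` and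
the cylinder transport, (M⁺⁺-3) on the whole triangle class). [this work] -/
theorem triWIneq_of_certKernelZero (h : CertKernelZero) : TriWIneq := by
  intro β γ _ _ _ _ P F G hP hF hG hFm hGm
  obtain ⟨w, hw⟩ := h β γ P F G hP hF hG hFm hGm
  exact triW_nonneg_of_certRow_linearIndependent P F G w hw

/-! ### The explicit direction table Σ at `a = 2` -/

/-- The explicit direction table Σ found by exhaustive search at `a = 2` (memo CERT-L §2; directions by class type and level `#x ∈ {0,1,2}`,
`e₁ = (1,0)`, `e₂ = (0,1)`, `e₃ = (1,1)`): `D2 ↦ (e₃, e₂, e₁)`, `D1 ↦ (e₁, e₃, e₂)`, `D3 ↦ (e₁, e₂, e₁)` — so copy 1 carries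
`{D2_⊥, D2_⊤, D1_⊥, D1_mid, D3_⊥, D3_⊤}` and copy 2 carries `{D2_⊥, D2_mid, D1_mid, D1_⊤, D3_mid}`.  With these 0/1 directions the certificate has
linearly independent rows on ALL 28,224 general-W instances with `W = 2^2` and on all 28,224 resp. 1,273,608 cylinder instances of the cells
`(2,2,2)` and `(2,3,2)` (exhaustive, this seat; `(2,2,3)` and general-W `n = 3` queued as kit j121102); it is full rank over `GF(2), GF(3), GF(5)`
as well, and `|det| = 1` on every tight (square) instance — a parameter-free target of the same kind as `rankZ_kernel_eq_zero`.
Levels `#x > 2` (irrelevant at `a = 2`) are sent to `e₁`. [this work] -/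
def certSigmaWeight (p : Fin 3 × Finset β) : Fin 2 → ℚ :=
  match p.1, p.2.card with
  | 0, 0 => ![1, 1]
  | 0, 1 => ![0, 1]
  | 0, _ => ![1, 0]
  | 1, 0 => ![1, 0]
  | 1, 1 => ![1, 1]
  | 1, _ => ![0, 1]
  | 2, 1 => ![0, 1]
  | 2, _ => ![1, 0]

/-- **Σ-kernel statement at `a = 2`** (OPEN, census-clean; the recommended target): for a two-element index type `β` the certificate with the
explicit table `certSigmaWeight` has linearly independent rows.  By `triW_nonneg_of_certRow_linearIndependent` it gives `0 ≤ triW P F G`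
whenever `Fintype.card β = 2`, i.e. TRI ≥ 0 on every cell `(2,b,c)` — with the thin edge, on every cell with a block of size ≤ 2. [this work] -/
@[conjecture] def CertSigmaKernelZero : Prop :=
  ∀ (β γ : Type) [DecidableEq β] [Fintype β] [DecidableEq γ] [Fintype γ], Fintype.card β = 2 →
    ∀ (P : Finset (Finset γ)) (F G : Finset β → Finset (Finset γ)),
    IsUpperSet (P : Set (Finset γ)) → (∀ x, IsUpperSet (F x : Set (Finset γ))) → (∀ x, IsUpperSet (G x : Set (Finset γ))) →
    Monotone F → Monotone G → LinearIndependent ℚ (certRow P F G certSigmaWeight)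

/-- `CertSigmaKernelZero` gives `TRI_W(2) ≥ 0`: `0 ≤ triW P F G` for every two-element index cube. [this work] -/
theorem triW_nonneg_of_certSigmaKernelZero (h : CertSigmaKernelZero) (hβ : Fintype.card β = 2)
    (P : Finset (Finset γ)) (F G : Finset β → Finset (Finset γ))
    (hP : IsUpperSet (P : Set (Finset γ))) (hF : ∀ x, IsUpperSet (F x : Set (Finset γ)))
    (hG : ∀ x, IsUpperSet (G x : Set (Finset γ))) (hFm : Monotone F) (hGm : Monotone G) : 0 ≤ triW P F G :=
  triW_nonneg_of_certRow_linearIndependent P F G certSigmaWeight (h β γ hβ P F G hP hF hG hFm hGm)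

/-! ### The decoupled certificate: independent reflected families (memo CERT-L §9, 'GEN') -/

/-- Row index of the DECOUPLED certificate: the reflected occurrences of `F`, `G` are replaced by independent monotone families `Q`, `H`
(intended: `Q x ⊆ F x`, `H x ⊆ G x`): `D2_x = P ∩ F x ∩ refl (H xᶜ)`, `D1_x = P ∩ refl (Q x) ∩ G xᶜ`, `D3_x = P ∩ refl (Q x) ∩ refl (H x)`. [this work] -/
abbrev CertGenRowIdx (P : Finset (Finset γ)) (F G Q H : Finset β → Finset (Finset γ)) : Type :=
  Σ x : Finset β, (↥(P ∩ F x ∩ refl (H xᶜ)) ⊕ (↥(P ∩ refl (Q x) ∩ G xᶜ) ⊕ ↥(P ∩ refl (Q x) ∩ refl (H x))))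

/-- Column index of the decoupled certificate: two copies of `⊔_y P ∩ F y ∩ G y` plus `T4_x = P ∩ refl (Q x) ∩ refl (H xᶜ)`. [this work] -/
abbrev CertGenColIdx (P : Finset (Finset γ)) (F G Q H : Finset β → Finset (Finset γ)) : Type :=
  ((Σ y : Finset β, ↥(P ∩ F y ∩ G y)) × Fin 2) ⊕ (Σ x : Finset β, ↥(P ∩ refl (Q x) ∩ refl (H xᶜ)))

/-- The rows of the decoupled certificate (same gauge and tags as `certRow`, with `Q, H` in the reflected slots). [this work] -/
def certGenRow (P : Finset (Finset γ)) (F G Q H : Finset β → Finset (Finset γ)) (w : Fin 3 × Finset β → Fin 2 → ℚ) :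
    CertGenRowIdx P F G Q H → CertGenColIdx P F G Q H → ℚ
  | ⟨x, Sum.inl d⟩, Sum.inl (⟨y, t⟩, i) => if x ⊆ y ∧ (d : Finset γ) ⊆ (t : Finset γ) then w (0, x) i else 0
  | ⟨_, Sum.inl _⟩, Sum.inr _ => 0
  | ⟨x, Sum.inr (Sum.inl d)⟩, Sum.inl (⟨y, t⟩, i) => if x ⊆ y ∧ (d : Finset γ) ⊆ (t : Finset γ) then w (1, x) i else 0
  | ⟨_, Sum.inr (Sum.inl _)⟩, Sum.inr _ => 0
  | ⟨x, Sum.inr (Sum.inr d)⟩, Sum.inl (⟨y, t⟩, i) => if x ⊆ y ∧ (d : Finset γ) ⊆ (t : Finset γ) then w (2, x) i else 0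
  | ⟨x, Sum.inr (Sum.inr d)⟩, Sum.inr ⟨x₀, e⟩ => if x₀ ⊆ x ∧ (e : Finset γ) = (d : Finset γ) then 1 else 0

/-- With `Q = F`, `H = G` the decoupled rows are the certificate rows. [this work] -/
theorem certGenRow_self (P : Finset (Finset γ)) (F G : Finset β → Finset (Finset γ)) (w : Fin 3 × Finset β → Fin 2 → ℚ) :
    certGenRow P F G F G w = certRow P F G w := by
  funext i j
  rcases i with ⟨x, d | d | d⟩ <;> rcases j with ⟨⟨y, t⟩, c⟩ | ⟨x₀, e⟩ <;> rfl

/-- **GEN (decoupled kernel form), all `a`** — OPEN, census-clean (memo CERT-L §9: general-W `(n,a) = (3,2), (2,3), (3,3)`, 120,000 random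
instances with `Q ⊆ F`, `H ⊆ G` and generic per-class directions: 0 failures; the nesting `Q ⊆ F`, `H ⊆ G` is necessary — the other relaxations
fail): for monotone up-set families with `Q x ⊆ F x`, `H x ⊆ G x` SOME direction table makes the decoupled rows independent.  It is the recommended
form of the target for an inductive proof (it is what the `a = 1` proof `rankZ_kernel_eq_zero` actually uses).  An obligation, never a fact. [this work] -/
@[conjecture] def CertGenKernelZero : Prop :=
  ∀ (β γ : Type) [DecidableEq β] [Fintype β] [DecidableEq γ] [Fintype γ]
    (P : Finset (Finset γ)) (F G Q H : Finset β → Finset (Finset γ)),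
    IsUpperSet (P : Set (Finset γ)) → (∀ x, IsUpperSet (F x : Set (Finset γ))) → (∀ x, IsUpperSet (G x : Set (Finset γ))) →
    (∀ x, IsUpperSet (Q x : Set (Finset γ))) → (∀ x, IsUpperSet (H x : Set (Finset γ))) →
    Monotone F → Monotone G → Monotone Q → Monotone H → (∀ x, Q x ⊆ F x) → (∀ x, H x ⊆ G x) →
    ∃ w : Fin 3 × Finset β → Fin 2 → ℚ, LinearIndependent ℚ (certGenRow P F G Q H w)

/-- `CertGenKernelZero → CertKernelZero` (take `Q = F`, `H = G`). [this work] -/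
theorem certKernelZero_of_gen (h : CertGenKernelZero) : CertKernelZero := by
  intro β γ _ _ _ _ P F G hP hF hG hFm hGm
  obtain ⟨w, hw⟩ := h β γ P F G F G hP hF hG hF hG hFm hGm hFm hGm (fun _ => Subset.rfl) (fun _ => Subset.rfl)
  exact ⟨w, by rwa [certGenRow_self] at hw⟩

/-- **GEN-Σ** — the decoupled `a = 2` statement with the explicit table `certSigmaWeight` (OPEN, census-clean: general-W `W = 2^2, 2^3, 2^4`,
250,000 random `(P, G, Q ⊆ F, H ⊆ G)`: 0 failures; memo CERT-L §9). [this work] -/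
@[conjecture] def CertGenSigmaKernelZero : Prop :=
  ∀ (β γ : Type) [DecidableEq β] [Fintype β] [DecidableEq γ] [Fintype γ], Fintype.card β = 2 →
    ∀ (P : Finset (Finset γ)) (F G Q H : Finset β → Finset (Finset γ)),
    IsUpperSet (P : Set (Finset γ)) → (∀ x, IsUpperSet (F x : Set (Finset γ))) → (∀ x, IsUpperSet (G x : Set (Finset γ))) →
    (∀ x, IsUpperSet (Q x : Set (Finset γ))) → (∀ x, IsUpperSet (H x : Set (Finset γ))) →
    Monotone F → Monotone G → Monotone Q → Monotone H → (∀ x, Q x ⊆ F x) → (∀ x, H x ⊆ G x) →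
    LinearIndependent ℚ (certGenRow P F G Q H certSigmaWeight)

/-- `CertGenSigmaKernelZero → CertSigmaKernelZero`. [this work] -/
theorem certSigmaKernelZero_of_gen (h : CertGenSigmaKernelZero) : CertSigmaKernelZero := by
  intro β γ _ _ _ _ hβ P F G hP hF hG hFm hGm
  have hw := h β γ hβ P F G F G hP hF hG hF hG hFm hGm hFm hGm (fun _ => Subset.rfl) (fun _ => Subset.rfl)
  rwa [certGenRow_self] at hw

/-! ### Token-dependent directions (row splits) -/

/-- The certificate rows with a direction chosen PER TOKEN (`w : CertRowIdx P F G → Fin 2 → ℚ`); the special case of 0/1 directions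
is a SPLIT of the demand tokens between the two copies (memo CERT-L §10: per instance such splits exist; a describable one would prove
`TriWIneq` with no genericity at all). [this work] -/
def certRowTok (P : Finset (Finset γ)) (F G : Finset β → Finset (Finset γ)) (w : CertRowIdx P F G → Fin 2 → ℚ) :
    CertRowIdx P F G → CertColIdx P F G → ℚ
  | ⟨x, Sum.inl d⟩, Sum.inl (⟨y, t⟩, i) => if x ⊆ y ∧ (d : Finset γ) ⊆ (t : Finset γ) then w ⟨x, Sum.inl d⟩ i else 0
  | ⟨_, Sum.inl _⟩, Sum.inr _ => 0
  | ⟨x, Sum.inr (Sum.inl d)⟩, Sum.inl (⟨y, t⟩, i) => if x ⊆ y ∧ (d : Finset γ) ⊆ (t : Finset γ) then w ⟨x, Sum.inr (Sum.inl d)⟩ i else 0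
  | ⟨_, Sum.inr (Sum.inl _)⟩, Sum.inr _ => 0
  | ⟨x, Sum.inr (Sum.inr d)⟩, Sum.inl (⟨y, t⟩, i) =>
      if x ⊆ y ∧ (d : Finset γ) ⊆ (t : Finset γ) then w ⟨x, Sum.inr (Sum.inr d)⟩ i else 0
  | ⟨x, Sum.inr (Sum.inr d)⟩, Sum.inr ⟨x₀, e⟩ => if x₀ ⊆ x ∧ (e : Finset γ) = (d : Finset γ) then 1 else 0

/-- Counting bridge for token-dependent directions: independent rows ⟹ `0 ≤ triW P F G`. [this work] -/
theorem triW_nonneg_of_certRowTok_linearIndependent (P : Finset (Finset γ)) (F G : Finset β → Finset (Finset γ))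
    (w : CertRowIdx P F G → Fin 2 → ℚ) (h : LinearIndependent ℚ (certRowTok P F G w)) : 0 ≤ triW P F G := by
  have hcard := h.fintype_card_le_finrank
  rw [Module.finrank_fintype_fun_eq_card] at hcard
  rw [triW_eq_card_sub_card]
  have : (Fintype.card (CertRowIdx P F G) : ℤ) ≤ Fintype.card (CertColIdx P F G) := by exact_mod_cast hcard
  omega

/-- The class-direction certificate is the token-direction certificate with `w` constant on classes. [this work] -/
theorem certRowTok_of_class (P : Finset (Finset γ)) (F G : Finset β → Finset (Finset γ)) (w : Fin 3 × Finset β → Fin 2 → ℚ) :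
    certRowTok P F G (fun r => match r with
      | ⟨x, Sum.inl _⟩ => w (0, x)
      | ⟨x, Sum.inr (Sum.inl _)⟩ => w (1, x)
      | ⟨x, Sum.inr (Sum.inr _)⟩ => w (2, x)) = certRow P F G w := by
  funext i j
  rcases i with ⟨x, d | d | d⟩ <;> rcases j with ⟨⟨y, t⟩, c⟩ | ⟨x₀, e⟩ <;> rfl

end FiveUpSet

end Summit.CriticalPhenomena.PercolationContinuityZ3.Theorems
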